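import Summits.BirchSwinnertonDyer.BirchSwinnertonDyer.Theorems.CumulativeHeegnerLeopoldtRedSplitControlAtThreeShaTwoNativeAssembly
import Literature.NumberTheory.GaloisRepresentations.HomDualShaTwoLocalGlobalReduction
import Literature.NumberTheory.GaloisCohomology.ShaTwoUnitsVanishing
import Literature.NumberTheory.GaloisRepresentations.ConjugationDescent
import Literature.NumberTheory.GaloisRepresentations.GaloisSubgroups
import Literature.NumberTheory.EllipticCurves.ShaRestriction
import Literature.NumberTheory.EllipticCurves.ZpExtensionProofs
import Literature.AnabelianGeometry.AbsoluteAnabelian.FundamentalExtensionRestrictionMLFBaseConj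
import HarnessLib

/-!
# K4 `RedSplitControlAtThree` — hypothesis (A) of the Poitou–Tate road discharged by Brauer–Hasse–Noether over `K(M)`
# (seat `bsd-line-chl-p2`, gen 7, §4 of the native `Ш²` assembly)

HONEST FRAMING (cell `bsd-wall`): BSD is NOT proved here and no case of Poitou–Tate duality is proved outright.  This file
proves the input (A3) of `HomDual.localGlobal_of_forall_evalPoint`, which removes hypothesis (A) from
`poitouTate_sha_tateDual_of_localGlobal` (file `…ShaTwoNativeAssembly`, §3; assembled in the sequel `…ShaTwoIdele`).

(A) said: for `c ∈ Ш²(K, M^D)` the class `H²(p^*)(H²(e) c) ∈ H²(K, Hom_ℤ(P, K̄ˣ))` vanishes.  By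
`HomDual.localGlobal_of_forall_evalPoint` (inf–res in degree 2 + Hilbert 90, landed) it suffices to prove
(A3) `H²(U ↪ Γ_K, ev_m)(c) = 0 ∈ H²(U, K̄ˣ)` for every `m ∈ M`, `U = Gal(K̄/K(M))`.  This file proves (A3):
* §1 `map_tower_two_eq_zero_of_localization_eq_zero` — LOCAL TRIVIALITY ASCENDS a finite extension `L/K` in degree 2: for
  a finite place `w ∣ v` the composite `Γ_{L_w} → Γ_L → Γ_K` is conjugate in `Γ_K` to `Γ_{L_w} → Γ_{K_v} → Γ_K`
  (`exists_algHom_eq_comp`, `resGalOfEmb_comp(_tower)`), and inner automorphisms act trivially on `H²`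
  (`map_eq_map_of_inner_two`); so `loc_v c = 0 ⟹ H²(Γ_{L_w} → Γ_K, F)(c) = 0` for ANY coefficient map `F`.
* §2 `map_absGaloisRestrict_evalTransfer_eq_zero_of_mem_shaTwo` — for `c ∈ Ш²(K, M^D)` and `m' ∈ M` the class
  `H²(Γ_{K(M)} → Γ_K, ι ∘ ev_{m'})(c) ∈ H²(K(M), \bar{K(M)}ˣ)` is locally trivial (§1 at finite places; `K(M)` is totally
  complex at infinite ones), hence zero by Brauer–Hasse–Noether (`shaTwo_units_eq_bot`-style
  `eq_zero_of_forall_localization_units_two_eq_zero`, landed).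
* §3 `map_evalPointHom_eq_zero_of_mem_shaTwo` = (A3): transport from the number field `K(M)` (where BHN lives) to the
  subgroup `U ≤ Γ_K` (where inf–res lives) along `e : U ≃ₜ* Γ_{K(M)}`, which differs from the inclusion by ONE inner
  automorphism of `Γ_K` (`exists_absGaloisRestrict_fixingSubgroupEquivAbsoluteGaloisGroup_eq_conj`); the comparison map
  `H²(e⁻¹, u ↦ ι(γu))` is injective (explicit inverse), and `map_eq_map_of_inner_two` again.
The sequel `…ShaTwoIdele` turns (A3) into (A) (`tateDual_localGlobal`) and records PT2 ⟸ doors' package + (B).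

## References
* J. S. Milne, *Arithmetic Duality Theorems* (2006), I Thm. 4.10 and its proof (p. 58), I Lemma 4.13. [MilneADT2006]
* J.-P. Serre, *Local Fields* (1979), VII §5 Prop. 3; *Galois Cohomology* (1997), II §1.1. [SerreLocalFields1979]
* J. Neukirch, A. Schmidt, K. Wingberg, *Cohomology of Number Fields* (2008), (8.1.17) (BHN), (1.6.2). [NeukirchSchmidtWingberg2008]
-/

noncomputable section

open Function NumberField IsDedekindDomain CategoryTheory
open scoped NumberField ContRepresentation

-- `Summit.<P>.<Sub>` repeats `BirchSwinnertonDyer` by the tree's layout convention (D-0017)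
set_option linter.dupNamespace false

namespace Summit.BirchSwinnertonDyer.BirchSwinnertonDyer.Theorems.PoitouTateShaTwoReadout

open Field
open _root_.TopRep _root_.ContinuousCohomology
open Literature.NumberTheory.GaloisRepresentations Literature.NumberTheory.GaloisCohomology
open Literature.NumberTheory.GaloisRepresentations.DiscreteGaloisModule (TateDual tateDual units UnitsCarrier MuCarrier shaTwo
  mem_shaTwo_iff mu unramifiedSubgroup localTatePairingZMod)
open Literature.NumberTheory.EllipticCurves (closureEmb resGal resGalOfEmb exists_algHom_eq_comp resGalOfEmb_comp
  resGalOfEmb_comp_tower adicCompletionMap adicCompletionMap_coe)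
open Summit.BirchSwinnertonDyer.Rank1Residual.X11b

/-! ## §1 Local triviality ascends a finite extension (degree 2, finite places) -/

section Ascend

variable {K : Type} [Field K] [NumberField K]
variable {V : Type} [AddCommGroup V] [TopologicalSpace V] [DiscreteTopology V] (X : DiscreteGaloisModule K V)

/-- **Local triviality ascends `L/K` in degree 2.**  For a finite place `w` of `L` above `v = w ∩ 𝓞_K`, a class
`c ∈ H²(K, X)` with `loc_v c = 0` and ANY morphism of coefficients `F : X|_{Γ_{L_w}} → Y` along the composite
`Γ_{L_w} → Γ_L → Γ_K`: `H²(Γ_{L_w} → Γ_L → Γ_K, F)(c) = 0`.  The composite is conjugate (by one `g ∈ Γ_K`, from the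
two `K`-embeddings `K̄ → \bar{L_w}`) to `Γ_{L_w} → Γ_{K_v} → Γ_K`, inner automorphisms act trivially on `H²`, and the
second route factors through `loc_v c = 0`. [cite: SerreLocalFields1979, VII §5 Prop. 3][cite: MilneADT2006, I §4] -/
theorem map_tower_two_eq_zero_of_localization_eq_zero (L : Type) [Field L] [NumberField L] [Algebra K L]
    (w : HeightOneSpectrum (𝓞 L)) {W : Type} [AddCommGroup W] [TopologicalSpace W] [DiscreteTopology W]
    (Y : DiscreteGaloisModule (w.adicCompletion L) W)
    (F : TopRep.res (((absGaloisRestrict K L).comp (absGaloisRestrict L (w.adicCompletion L)) :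
        absoluteGaloisGroup (w.adicCompletion L) →ₜ* absoluteGaloisGroup K) :
        absoluteGaloisGroup (w.adicCompletion L) →* absoluteGaloisGroup K) X.toTopRep ⟶ Y.toTopRep)
    (c : galoisCohomology X 2)
    (hc : galoisCohomology.localization X (Sum.inr (w.under (𝓞 K))) 2 c = 0) :
    ContinuousCohomology.map ((absGaloisRestrict K L).comp (absGaloisRestrict L (w.adicCompletion L))) F 2 c = 0 := by
  set v : HeightOneSpectrum (𝓞 K) := w.under (𝓞 K) with hv
  haveI := absoluteGaloisGroup_compactSpace K
  haveI := absoluteGaloisGroup_compactSpace (w.adicCompletion L)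
  haveI := absoluteGaloisGroup_compactSpace (v.adicCompletion K)
  -- the tower `K → K_v → L_w`
  haveI : w.asIdeal.LiesOver v.asIdeal := ⟨rfl⟩
  letI : Algebra (v.adicCompletion K) (w.adicCompletion L) := (adicCompletionMap (K := K) L v w).toAlgebra
  haveI : IsScalarTower K (v.adicCompletion K) (w.adicCompletion L) :=
    IsScalarTower.of_algebraMap_eq fun x ↦ (adicCompletionMap_coe (K := K) L v w x).symm
  -- the two embeddings `K̄ → \bar{L_w}` and the conjugating element
  let ιL : AlgebraicClosure K →ₐ[K] AlgebraicClosure L := closureEmb (K := K) L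
  let ι₃ : AlgebraicClosure L →ₐ[L] AlgebraicClosure (w.adicCompletion L) := closureEmb (K := L) (w.adicCompletion L)
  let ιv : AlgebraicClosure K →ₐ[K] AlgebraicClosure (v.adicCompletion K) := closureEmb (K := K) (v.adicCompletion K)
  let ι₂ : AlgebraicClosure (v.adicCompletion K) →ₐ[v.adicCompletion K] AlgebraicClosure (w.adicCompletion L) :=
    closureEmb (K := v.adicCompletion K) (w.adicCompletion L)
  obtain ⟨g₀, hg⟩ := exists_algHom_eq_comp ((ι₂.restrictScalars K).comp ιv) ((ι₃.restrictScalars K).comp ιL)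
  let g : absoluteGaloisGroup K := g₀
  let θA : absoluteGaloisGroup (w.adicCompletion L) →ₜ* absoluteGaloisGroup K :=
    (absGaloisRestrict K L).comp (absGaloisRestrict L (w.adicCompletion L))
  let θB : absoluteGaloisGroup (w.adicCompletion L) →ₜ* absoluteGaloisGroup K :=
    (absGaloisRestrict K (v.adicCompletion K)).comp (absGaloisRestrict (v.adicCompletion K) (w.adicCompletion L))
  have key : ∀ τ, θA τ = g⁻¹ * θB τ * g := fun τ ↦ by
    change resGal (K := K) L (resGal (K := L) (w.adicCompletion L) τ) =
      g⁻¹ * resGal (K := K) (v.adicCompletion K) (resGal (K := v.adicCompletion K) (w.adicCompletion L) τ) * g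
    have h1 : resGal (K := K) L (resGal (K := L) (w.adicCompletion L) τ) =
        resGalOfEmb ((ι₃.restrictScalars K).comp ιL) τ := by
      rw [resGalOfEmb_comp_tower ιL ι₃]; rfl
    have h2 : resGal (K := K) (v.adicCompletion K) (resGal (K := v.adicCompletion K) (w.adicCompletion L) τ) =
        resGalOfEmb ((ι₂.restrictScalars K).comp ιv) τ := by
      rw [resGalOfEmb_comp_tower ιv ι₂]; rfl
    rw [h1, h2, hg, resGalOfEmb_comp]
    rfl
  -- `F ∘ g⁻¹` is equivariant along the second route
  have hcomm : ∀ (τ : absoluteGaloisGroup (w.adicCompletion L)) (x : V),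
      F.hom (X g⁻¹ (X (θB τ) x)) = Y τ (F.hom (X g⁻¹ x)) := fun τ x ↦ by
    have hx : X g⁻¹ (X (θB τ) x) = X (θA τ) (X g⁻¹ x) := by
      rw [← Module.End.mul_apply, ← map_mul, ← Module.End.mul_apply, ← map_mul, key]
      congr 2
      group
    rw [hx]
    exact TopRep.hom_comm_apply F τ (X g⁻¹ x)
  let ginv : V →L[ℤ] V := { toLinearMap := X g⁻¹, cont := continuous_of_discreteTopology }
  let f₂ : TopRep.res (θB : absoluteGaloisGroup (w.adicCompletion L) →* absoluteGaloisGroup K) X.toTopRep ⟶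
      Y.toTopRep :=
    TopRep.ofHom ⟨F.hom.toContinuousLinearMap.comp ginv, fun τ => by
      refine ContinuousLinearMap.ext fun x => ?_
      change F.hom (X g⁻¹ (X (θB τ) x)) = Y τ (F.hom (X g⁻¹ x))
      exact hcomm τ x⟩
  have hinner : ContinuousCohomology.map θA F 2 c = ContinuousCohomology.map θB f₂ 2 c :=
    map_eq_map_of_inner_two g θB θA key F f₂ (fun x => by
      change F.hom x = F.hom (X g⁻¹ (X g x))
      rw [← Module.End.mul_apply, ← map_mul, inv_mul_cancel, map_one, Module.End.one_apply]) c
  -- the second route factors through `loc_v c = 0`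
  let f₂' : TopRep.res (absGaloisRestrict (v.adicCompletion K) (w.adicCompletion L) :
      absoluteGaloisGroup (w.adicCompletion L) →* absoluteGaloisGroup (v.adicCompletion K))
        (X.restrictField (v.adicCompletion K)).toTopRep ⟶ Y.toTopRep :=
    TopRep.ofHom ⟨F.hom.toContinuousLinearMap.comp ginv, fun τ => by
      refine ContinuousLinearMap.ext fun x => ?_
      change F.hom (X g⁻¹ (X (θB τ) x)) = Y τ (F.hom (X g⁻¹ x))
      exact hcomm τ x⟩
  have hc' : ContinuousCohomology.map (absGaloisRestrict K (v.adicCompletion K))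
      (TopRep.ofHom ⟨ContinuousLinearMap.id ℤ V, fun _ => rfl⟩ :
        TopRep.res (absGaloisRestrict K (v.adicCompletion K) : _ →* absoluteGaloisGroup K) X.toTopRep ⟶
          (X.restrictField (v.adicCompletion K)).toTopRep) 2 c = 0 := hc
  change ContinuousCohomology.map θA F 2 c = 0
  rw [hinner, map_comp_apply_of (absGaloisRestrict K (v.adicCompletion K))
    (absGaloisRestrict (v.adicCompletion K) (w.adicCompletion L)) θB (fun _ => rfl)
    (TopRep.ofHom ⟨ContinuousLinearMap.id ℤ V, fun _ => rfl⟩) f₂' f₂ (fun _ => rfl) 2 c, hc']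
  exact map_zero _

end Ascend

/-! ## §2 `H²(Γ_L → Γ_K, F)(c) = 0` in `H²(L, L̄ˣ)` for `c ∈ Ш²(K, X)` and `L` totally complex (Brauer–Hasse–Noether) -/

section BHN

variable {K : Type} [Field K] [NumberField K]
variable {V : Type} [AddCommGroup V] [TopologicalSpace V] [DiscreteTopology V] (X : DiscreteGaloisModule K V)

/-- **A class of `Ш²(K, X)` pushed to `H²(L, L̄ˣ)` along ANY coefficient map dies** (`L/K` finite, `L` totally complex):
its localisations vanish at the finite places of `L` by §1 and at the (complex) infinite places because `Γ_ℂ = 1`, so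
Brauer–Hasse–Noether (`eq_zero_of_forall_localization_units_two_eq_zero`) applies.
[cite: NeukirchSchmidtWingberg2008, (8.1.17)][cite: MilneADT2006, I §4] -/
theorem map_absGaloisRestrict_units_eq_zero_of_mem_shaTwo (L : Type) [Field L] [NumberField L] [Algebra K L]
    [IsTotallyComplex L]
    (F : TopRep.res (absGaloisRestrict K L : absoluteGaloisGroup L →* absoluteGaloisGroup K) X.toTopRep ⟶
      (units L).toTopRep)
    (c : galoisCohomology X 2) (hc : c ∈ shaTwo X) :
    ContinuousCohomology.map (absGaloisRestrict K L) F 2 c = 0 := by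
  haveI := absoluteGaloisGroup_compactSpace K
  haveI := absoluteGaloisGroup_compactSpace L
  refine eq_zero_of_forall_localization_units_two_eq_zero (K := L) _ fun p => ?_
  rcases p with w | w
  · exact WeakLeopoldt.localization_inl_two_eq_zero (IsTotallyComplex.isComplex w) _
  · haveI := absoluteGaloisGroup_compactSpace (w.adicCompletion L)
    let F' : TopRep.res (((absGaloisRestrict K L).comp (absGaloisRestrict L (w.adicCompletion L)) :
        absoluteGaloisGroup (w.adicCompletion L) →ₜ* absoluteGaloisGroup K) :
        absoluteGaloisGroup (w.adicCompletion L) →* absoluteGaloisGroup K) X.toTopRep ⟶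
          ((units L).restrictField (w.adicCompletion L)).toTopRep :=
      TopRep.ofHom ⟨F.hom.toContinuousLinearMap, fun τ => by
        refine ContinuousLinearMap.ext fun x => ?_
        change F.hom (X (absGaloisRestrict K L (absGaloisRestrict L (w.adicCompletion L) τ)) x) =
          units L (absGaloisRestrict L (w.adicCompletion L) τ) (F.hom x)
        exact TopRep.hom_comm_apply F _ x⟩
    change ContinuousCohomology.map (absGaloisRestrict L (w.adicCompletion L))
      (TopRep.ofHom ⟨ContinuousLinearMap.id ℤ (UnitsCarrier L), fun _ => rfl⟩ :
        TopRep.res (absGaloisRestrict L (w.adicCompletion L) : _ →* absoluteGaloisGroup L) (units L).toTopRep ⟶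
          ((units L).restrictField (w.adicCompletion L)).toTopRep) 2
      (ContinuousCohomology.map (absGaloisRestrict K L) F 2 c) = 0
    rw [← map_comp_apply_of (absGaloisRestrict K L) (absGaloisRestrict L (w.adicCompletion L))
      ((absGaloisRestrict K L).comp (absGaloisRestrict L (w.adicCompletion L))) (fun _ => rfl) F
      (TopRep.ofHom ⟨ContinuousLinearMap.id ℤ (UnitsCarrier L), fun _ => rfl⟩) F' (fun _ => rfl) 2 c]
    exact map_tower_two_eq_zero_of_localization_eq_zero X L w ((units L).restrictField (w.adicCompletion L)) F' c
      ((mem_shaTwo_iff _ c).1 hc _)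

end BHN

/-! ## §3 (A3): `H²(U ↪ Γ_K, ev_m)(c) = 0` for `c ∈ Ш²(K, M^D)`, `U = Gal(K̄/K(M))` -/

section Transport

variable {K : Type} [Field K] [NumberField K]
variable {M : Type} [AddCommGroup M] [TopologicalSpace M] [DiscreteTopology M] [Finite M]
variable (ρ : DiscreteGaloisModule K M) (n : ℕ) (hM : ∀ m : M, n • m = 0)

open Literature.NumberTheory.GaloisRepresentations.HomDual (evalPointHom unitsTransferAddHom unitsTransferAddHom_smul
  unitsVal_unitsTransferAddHom apply_eq_of_mem_absGaloisFixingSubgroup_presentationLayer)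
open Literature.NumberTheory.GaloisRepresentations.FreePresentation (presentationLayer)
open Literature.FieldTheory.Galois (fixingSubgroupEquivAbsoluteGaloisGroup)
open Literature.AnabelianGeometry.AbsoluteAnabelian (exists_absGaloisRestrict_fixingSubgroupEquivAbsoluteGaloisGroup_eq_conj)
open LocalWeilDatum (galFixing)

omit [NumberField K] in
/-- `μ_n ↪ K̄ˣ` is `Γ_K`-equivariant (on carriers). [cite: SerreLocalFields1979, X §3] -/
theorem units_kummerInclAddHom (g : absoluteGaloisGroup K) (ζ : MuCarrier K n) :
    units K g (kummerInclAddHom K n ζ) = kummerInclAddHom K n (mu K n g ζ) :=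
  (TopRep.hom_comm_apply (kummerι K n) g ζ).symm

omit [NumberField K] in
/-- `u ↦ ι u : K̄ˣ → \bar{K′}ˣ` is bijective for `K′/K` algebraic (the chosen `ι : K̄ → \bar{K′}` is then an isomorphism).
[cite: MilneADT2006, I §0] -/
theorem unitsTransferAddHom_bijective (K' : Type) [Field K'] [Algebra K K'] [Algebra.IsAlgebraic K K'] :
    Function.Bijective (unitsTransferAddHom K K') := by
  have hι := absClosureEmbedding_bijective K K'
  refine ⟨fun u₁ u₂ h => ?_, fun u' => ?_⟩
  · apply unitsVal_injective K
    have h' := congrArg (fun u => ((unitsVal K' u : (AlgebraicClosure K')ˣ) : AlgebraicClosure K')) h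
    simp only [unitsVal_unitsTransferAddHom, Units.coe_map, MonoidHom.coe_coe] at h'
    exact Units.ext (hι.1 h')
  · obtain ⟨x, hx⟩ := hι.2 ((unitsVal K' u' : (AlgebraicClosure K')ˣ) : AlgebraicClosure K')
    have hx0 : x ≠ 0 := by
      rintro rfl
      rw [map_zero] at hx
      exact (unitsVal K' u').ne_zero hx.symm
    refine ⟨UnitsCarrier.ofUnits (Units.mk0 x hx0), unitsVal_injective K' (Units.ext ?_)⟩
    rw [unitsVal_unitsTransferAddHom, unitsVal_ofUnits, Units.coe_map, MonoidHom.coe_coe]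
    exact hx

/-- **(A3) — `H²(U ↪ Γ_K, ev_m)(c) = 0 ∈ H²(U, K̄ˣ)` for every `c ∈ Ш²(K, M^D)` and `m ∈ M`** (`K` totally complex,
`U = Gal(K̄/K(M))`).  Transport along `e : U ≃ₜ* Γ_{K(M)}` (conjugate to `U ↪ Γ_K` by one `γ ∈ Γ_K`): the comparison
`H²(e⁻¹, u ↦ ι(γu)) : H²(U, K̄ˣ) → H²(K(M), \overline{K(M)}ˣ)` is injective (explicit inverse) and maps `H²(U ↪ Γ_K, ev_m)(c)`
to `H²(Γ_{K(M)} → Γ_K, ι ∘ ev_{γm})(c)` (inner automorphisms act trivially on `H²`), which vanishes by §2.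
[cite: MilneADT2006, I Thm. 4.10 (proof, p. 58)][cite: SerreLocalFields1979, VII §5 Prop. 3]
[cite: NeukirchSchmidtWingberg2008, (8.1.17)] -/
theorem map_evalPointHom_eq_zero_of_mem_shaTwo [IsTotallyComplex K] (c : galoisCohomology (ρ.tateDual n) 2)
    (hc : c ∈ shaTwo (ρ.tateDual n)) (m : M) :
    haveI := (presentationLayer ρ).isGalois
    ContinuousCohomology.map (subgroupIncl (absGaloisFixingSubgroup (presentationLayer ρ).1))
      (evalPointHom ρ n hM m) 2 c = 0 := by
  haveI := (presentationLayer ρ).isGalois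
  haveI : FiniteDimensional K (presentationLayer ρ).1 := (presentationLayer ρ).finiteDimensional
  haveI : NumberField (presentationLayer ρ).1 := (presentationLayer ρ).numberField
  haveI : IsTotallyComplex (presentationLayer ρ).1 := isTotallyComplex_of_algebra K _
  haveI := absoluteGaloisGroup_compactSpace K
  haveI := absoluteGaloisGroup_compactSpace (presentationLayer ρ).1
  haveI : CompactSpace (absGaloisFixingSubgroup (presentationLayer ρ).1) :=
    isCompact_iff_compactSpace.mp
      (((absGaloisFixingSubgroup (presentationLayer ρ).1).isClosed_of_isOpen
        (isOpen_absGaloisFixingSubgroup K (presentationLayer ρ).1)).isCompact)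
  -- notation: `E = K(M) ⊆ K̄`, `U = Gal(K̄/E) ≤ Γ_K`, `ι = res_{E/K} : Γ_E → Γ_K`
  set E : IntermediateField K (AlgebraicClosure K) := (presentationLayer ρ).1 with hE
  set U : Subgroup (absoluteGaloisGroup K) := absGaloisFixingSubgroup E with hU
  have hUfix : ∀ (σ : U) (x : M), ρ (σ : absoluteGaloisGroup K) x = x := fun σ x =>
    apply_eq_of_mem_absGaloisFixingSubgroup_presentationLayer ρ σ.2 x
  -- `e : U ≃ₜ* Γ_E`, conjugate to the inclusion by `γ`
  have hUeq : U = galFixing K E := (galFixing_eq_absGaloisFixingSubgroup E).symm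
  let eU : U ≃ₜ* galFixing K E :=
    { MulEquiv.subgroupCongr hUeq with
      continuous_toFun := Continuous.subtype_mk continuous_subtype_val _
      continuous_invFun := Continuous.subtype_mk continuous_subtype_val _ }
  let e₀ : galFixing K E ≃ₜ* absoluteGaloisGroup E :=
    show E.fixingSubgroup ≃ₜ* absoluteGaloisGroup E from fixingSubgroupEquivAbsoluteGaloisGroup E
  let e : U ≃ₜ* absoluteGaloisGroup E := eU.trans e₀
  obtain ⟨γ, hγ⟩ := exists_absGaloisRestrict_fixingSubgroupEquivAbsoluteGaloisGroup_eq_conj K E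
  have he : ∀ σ : U, absGaloisRestrict K E (e σ) = γ * (σ : absoluteGaloisGroup K) * γ⁻¹ := fun σ => by
    have hσ : (σ : absoluteGaloisGroup K) ∈ galFixing K E := by rw [← hUeq]; exact σ.2
    exact hγ ⟨σ.1, hσ⟩
  have hι : ∀ τ : absoluteGaloisGroup E,
      absGaloisRestrict K E τ = γ * ((e.symm τ : U) : absoluteGaloisGroup K) * γ⁻¹ := fun τ => by
    conv_lhs => rw [← e.apply_symm_apply τ]
    exact he _
  have hfixι : ∀ (τ : absoluteGaloisGroup E) (x : M), ρ (absGaloisRestrict K E τ) x = x := fun τ x => by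
    rw [hι, map_mul, map_mul, Module.End.mul_apply, Module.End.mul_apply, hUfix, ← Module.End.mul_apply, ← map_mul,
      mul_inv_cancel, map_one, Module.End.one_apply]
  -- Step A (§2): `H²(ι, ι_E ∘ ev_{m'})(c) = 0` in `H²(E, Ēˣ)` for every `m'`
  let Fm : ∀ m' : M, TopRep.res (absGaloisRestrict K E : absoluteGaloisGroup E →* absoluteGaloisGroup K)
      (ρ.tateDual n).toTopRep ⟶ (units E).toTopRep := fun m' =>
    TopRep.ofHom ⟨{ toLinearMap :=
                      ({ toFun := fun φ : TateDual K M n => unitsTransferAddHom K E (kummerInclAddHom K n (φ m'))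
                         map_zero' := by
                           change unitsTransferAddHom K E (kummerInclAddHom K n 0) = 0
                           rw [map_zero, map_zero]
                         map_add' := fun φ ψ =>
                           map_add ((unitsTransferAddHom K E).comp (kummerInclAddHom K n)) (φ m') (ψ m') } :
                        TateDual K M n →+ UnitsCarrier E).toIntLinearMap
                    cont := continuous_of_discreteTopology }, fun τ => by
      refine ContinuousLinearMap.ext fun φ => ?_
      change unitsTransferAddHom K E (kummerInclAddHom K n ((ρ.tateDual n) (absGaloisRestrict K E τ) φ m')) =
        units E τ (unitsTransferAddHom K E (kummerInclAddHom K n (φ m')))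
      rw [DiscreteGaloisModule.tateDual_apply_apply_apply, ← map_inv, hfixι, ← units_kummerInclAddHom,
        unitsTransferAddHom_smul]⟩
  have hA : ∀ m' : M, ContinuousCohomology.map (absGaloisRestrict K E) (Fm m') 2 c = 0 := fun m' =>
    map_absGaloisRestrict_units_eq_zero_of_mem_shaTwo (ρ.tateDual n) E (Fm m') c hc
  -- Step B: the comparison `Φ = H²(e⁻¹, u ↦ ι_E (γ u))` and its left inverse `Ψ = H²(e, u' ↦ γ⁻¹ ι_E⁻¹ u')`
  let uT : UnitsCarrier K ≃+ UnitsCarrier E :=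
    AddEquiv.ofBijective (unitsTransferAddHom K E) (unitsTransferAddHom_bijective (K := K) E)
  have huT : ∀ u, uT u = unitsTransferAddHom K E u := fun _ => rfl
  let gU : TopRep.res ((e.symm : absoluteGaloisGroup E →ₜ* U) : absoluteGaloisGroup E →* U)
      ((units K).restrict (subgroupIncl U)).toTopRep ⟶ (units E).toTopRep :=
    TopRep.ofHom ⟨{ toLinearMap := ((uT : UnitsCarrier K →+ UnitsCarrier E).comp
                        (units K γ : UnitsCarrier K →ₗ[ℤ] UnitsCarrier K).toAddMonoidHom).toIntLinearMap
                    cont := continuous_of_discreteTopology }, fun τ => by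
      refine ContinuousLinearMap.ext fun u => ?_
      change uT (units K γ (units K ((e.symm τ : U) : absoluteGaloisGroup K) u)) = units E τ (uT (units K γ u))
      rw [huT, huT, ← unitsTransferAddHom_smul, hι, ← Module.End.mul_apply, ← map_mul, ← Module.End.mul_apply,
        ← map_mul]
      congr 2
      group⟩
  let gU' : TopRep.res ((e : U →ₜ* absoluteGaloisGroup E) : U →* absoluteGaloisGroup E) (units E).toTopRep ⟶
      ((units K).restrict (subgroupIncl U)).toTopRep :=
    TopRep.ofHom ⟨{ toLinearMap := ((units K γ⁻¹ : UnitsCarrier K →ₗ[ℤ] UnitsCarrier K).toAddMonoidHom.comp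
                        (uT.symm : UnitsCarrier E →+ UnitsCarrier K)).toIntLinearMap
                    cont := continuous_of_discreteTopology }, fun σ => by
      refine ContinuousLinearMap.ext fun u' => ?_
      obtain ⟨u, rfl⟩ := uT.surjective u'
      change units K γ⁻¹ (uT.symm (units E (e σ) (uT u))) = units K (σ : absoluteGaloisGroup K) (units K γ⁻¹ (uT.symm (uT u)))
      rw [uT.symm_apply_apply, huT, ← unitsTransferAddHom_smul, ← huT, uT.symm_apply_apply, he,
        ← Module.End.mul_apply, ← map_mul, ← Module.End.mul_apply, ← map_mul]
      congr 2
      group⟩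
  have hΨΦ : ∀ y, ContinuousCohomology.map (e : U →ₜ* absoluteGaloisGroup E) gU' 2
      (ContinuousCohomology.map (e.symm : absoluteGaloisGroup E →ₜ* U) gU 2 y) = y := fun y => by
    rw [← map_comp_apply_of (e.symm : absoluteGaloisGroup E →ₜ* U) (e : U →ₜ* absoluteGaloisGroup E)
      (ContinuousMonoidHom.id _) (fun σ => (e.symm_apply_apply σ).symm) gU gU'
      (TopRep.ofHom ⟨ContinuousLinearMap.id ℤ (UnitsCarrier K), fun _ => rfl⟩) (fun u => ?_) 2 y]
    · exact map_id_id_two _ y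
    · change u = units K γ⁻¹ (uT.symm (uT (units K γ u)))
      rw [uT.symm_apply_apply, ← Module.End.mul_apply, ← map_mul, inv_mul_cancel, map_one, Module.End.one_apply]
  -- Step C: `Φ (H²(U ↪ Γ_K, ev_m) c) = H²(θ, f₁)(c) = H²(ι, Fm (γ m))(c) = 0`
  let θ : absoluteGaloisGroup E →ₜ* absoluteGaloisGroup K :=
    (subgroupIncl U).comp (e.symm : absoluteGaloisGroup E →ₜ* U)
  have hθ : ∀ τ, θ τ = γ⁻¹ * absGaloisRestrict K E τ * γ := fun τ => by
    change ((e.symm τ : U) : absoluteGaloisGroup K) = _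
    rw [hι]
    group
  let f₁ : TopRep.res (θ : absoluteGaloisGroup E →* absoluteGaloisGroup K) (ρ.tateDual n).toTopRep ⟶
      (units E).toTopRep :=
    TopRep.ofHom ⟨{ toLinearMap :=
                      ({ toFun := fun φ : TateDual K M n => uT (units K γ (kummerInclAddHom K n (φ m)))
                         map_zero' := by
                           change uT (units K γ (kummerInclAddHom K n 0)) = 0
                           rw [map_zero, map_zero, map_zero]
                         map_add' := fun φ ψ =>
                           map_add (((uT : UnitsCarrier K →+ UnitsCarrier E).comp
                             (units K γ : UnitsCarrier K →ₗ[ℤ] UnitsCarrier K).toAddMonoidHom).comp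
                               (kummerInclAddHom K n)) (φ m) (ψ m) } :
                        TateDual K M n →+ UnitsCarrier E).toIntLinearMap
                    cont := continuous_of_discreteTopology }, fun τ => by
      refine ContinuousLinearMap.ext fun φ => ?_
      change uT (units K γ (kummerInclAddHom K n ((ρ.tateDual n) (θ τ) φ m))) =
        units E τ (uT (units K γ (kummerInclAddHom K n (φ m))))
      rw [DiscreteGaloisModule.tateDual_apply_apply_apply, ← map_inv, show ρ (θ τ⁻¹) m = m from hUfix _ m,
        ← units_kummerInclAddHom, huT, huT, ← unitsTransferAddHom_smul, hθ, hι, ← Module.End.mul_apply, ← map_mul,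
        ← Module.End.mul_apply, ← map_mul]
      congr 2
      group⟩
  have h1 : ContinuousCohomology.map (e.symm : absoluteGaloisGroup E →ₜ* U) gU 2
      (ContinuousCohomology.map (subgroupIncl U) (evalPointHom ρ n hM m) 2 c) =
        ContinuousCohomology.map θ f₁ 2 c :=
    (map_comp_apply_of (subgroupIncl U) (e.symm : absoluteGaloisGroup E →ₜ* U) θ (fun _ => rfl)
      (evalPointHom ρ n hM m) gU f₁ (fun _ => rfl) 2 c).symm
  have h2 : ContinuousCohomology.map θ f₁ 2 c = ContinuousCohomology.map (absGaloisRestrict K E) (Fm (ρ γ m)) 2 c :=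
    map_eq_map_of_inner_two γ (absGaloisRestrict K E) θ hθ f₁ (Fm (ρ γ m)) (fun φ => by
      change uT (units K γ (kummerInclAddHom K n (φ m))) =
        unitsTransferAddHom K E (kummerInclAddHom K n ((ρ.tateDual n) γ φ (ρ γ m)))
      rw [DiscreteGaloisModule.tateDual_apply_apply_apply, ← Module.End.mul_apply, ← map_mul, inv_mul_cancel, map_one,
        Module.End.one_apply, ← units_kummerInclAddHom, huT]) c
  rw [← hΨΦ (ContinuousCohomology.map (subgroupIncl U) (evalPointHom ρ n hM m) 2 c), h1, h2, hA]
  exact map_zero _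

end Transport

end Summit.BirchSwinnertonDyer.BirchSwinnertonDyer.Theorems.PoitouTateShaTwoReadout

end
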